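import Mathlib
import HarnessLib
import Literature.MeasureTheory.Integral.EndpointSingularitySubstitution

/-!
# Gauss–Chebyshev rules of the first and second kind
(Davis–Rabinowitz 1984, Sect. 2.7, Corollary (2.7.13)–(2.7.14))

Davis–Rabinowitz, *Methods of Numerical Integration* (2nd ed., 1984), Sect. 2.7 "Integration formulas
of Gauss type", Corollary following (2.7.12): for the weight `w(x) = (1 - x²)^{-1/2}` on `[-1, 1]` the
Gauss rule is the equal-weight rule
`∫_{-1}^{1} f(x) (1 - x²)^{-1/2} dx = (π/n) Σ_{k=1}^{n} f(x_k) + π/(2^{2n-1} (2n)!) f^{(2n)}(ξ)`,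
`x_k = cos((2k-1)π/(2n))` (2.7.13), and for `w(x) = (1 - x²)^{1/2}`
`∫_{-1}^{1} f(x) (1 - x²)^{1/2} dx = Σ_{k=1}^{n} w_k f(x_k) + π/(2^{2n+1} (2n)!) f^{(2n)}(ξ)`,
`x_k = cos(kπ/(n+1))`, `w_k = π/(n+1) · sin²(kπ/(n+1))` (2.7.14).

We record both rules in the angle variable `x = cos θ`, in which the two weights become `dθ` and
`sin²θ dθ` on `[0, π]` (the substitution `∫_{-1}^{1} f(x) (1-x²)^{-1/2} dx = ∫_0^π f(cos θ) dθ` is the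
classical Chebyshev substitution and is not repeated here):

* `gaussChebyshevRule₁ n f = (π/n) Σ_{i<n} f(cos((2i+1)π/(2n)))` and
  `gaussChebyshevRule₂ n f = Σ_{i<n} (π/(n+1)) sin²((i+1)π/(n+1)) · f(cos((i+1)π/(n+1)))`
  (0-based indexing of the text's nodes);
* the node sums `Σ_{i<n} cos(m(2i+1)π/(2n)) = 0` for `0 < m < 2n` and
  `Σ_{i<n} cos(m(i+1)π/(n+1)) = -(1 + (-1)^m)/2` for `0 < m < 2(n+1)` (telescoping);
* EXACTNESS on the Chebyshev bases: `∫_0^π T_m(cos θ) dθ = gaussChebyshevRule₁ n T_m` and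
  `∫_0^π U_m(cos θ) sin²θ dθ = gaussChebyshevRule₂ n U_m` for all `m ≤ 2n - 1`, hence, by linearity and
  induction on the degree, for every real polynomial of degree `≤ 2n - 1` (precision `2n - 1`, as for
  every `n`-point Gauss rule);
* the DEFECT at degree `2n`: `∫_0^π T_{2n}(cos θ) dθ - gaussChebyshevRule₁ n T_{2n} = π` and
  `∫_0^π U_{2n}(cos θ) sin²θ dθ - gaussChebyshevRule₂ n U_{2n} = π/2`; since `T_{2n}^{(2n)} ≡ 2^{2n-1}(2n)!`
  and `U_{2n}^{(2n)} ≡ 2^{2n}(2n)!`, these are exactly the error terms `π/(2^{2n-1}(2n)!) f^{(2n)}` of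
  (2.7.13) and `π/(2^{2n+1}(2n)!) f^{(2n)}` of (2.7.14) evaluated at `f = T_{2n}`, `f = U_{2n}`: both printed
  error constants are attained, so neither rule has precision `2n`.

RELATION TO MATHLIB. Mathlib already proves the exactness half of (2.7.13) — the first-kind rule — as
`Polynomial.Chebyshev.integral_eq_sumZeroes` (`∫ P d(measureT) = sumZeroes n P` for `deg P < 2n`, via
complex exponential sums). This file restates it in the text's quadrature-rule form with an elementary real
(telescoping) proof, bridges the two (`gaussChebyshevRule₁_eq_sumZeroes`,
`integral_measureT_eq_gaussChebyshevRule₁`), and adds what Mathlib does not have: the second-kind rule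
(2.7.14) with its exactness, and for both rules the degree-`2n` defect identified with the printed error
constant (precision exactly `2n - 1`).

The derivative form of the error for a general `f ∈ C^{2n}[-1, 1]` ((2.7.12) with an unknown `ξ`) is not
formalised here.
-/

namespace Literature.Analysis.Quadrature

open Real Finset Polynomial Polynomial.Chebyshev intervalIntegral

noncomputable section

/-! ## The rules -/

/-- First-kind Gauss–Chebyshev angles `θ_i = (2i+1)π/(2n)`, `i = 0, …, n-1` (the text's
`(2k-1)π/(2n)`, `k = 1, …, n`). [cite: DavisRabinowitz1984, Sect. 2.7 (2.7.13)] -/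
def gcAngle₁ (n i : ℕ) : ℝ := (2 * i + 1) * π / (2 * n)

/-- First-kind Gauss–Chebyshev nodes `x_i = cos((2i+1)π/(2n))`, the zeros of `T_n`.
[cite: DavisRabinowitz1984, Sect. 2.7 (2.7.13)] -/
def gcNode₁ (n i : ℕ) : ℝ := cos (gcAngle₁ n i)

/-- The `n`-point Gauss–Chebyshev rule of the first kind, `(π/n) Σ_{i<n} f(x_i)` (equal weights `π/n`).
[cite: DavisRabinowitz1984, Sect. 2.7 (2.7.13)] -/
def gaussChebyshevRule₁ (n : ℕ) (f : ℝ → ℝ) : ℝ := π / n * ∑ i ∈ range n, f (gcNode₁ n i)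

/-- Second-kind Gauss–Chebyshev angles `φ_i = (i+1)π/(n+1)`, `i = 0, …, n-1` (the text's `kπ/(n+1)`,
`k = 1, …, n`). [cite: DavisRabinowitz1984, Sect. 2.7 (2.7.14)] -/
def gcAngle₂ (n i : ℕ) : ℝ := (i + 1) * π / (n + 1)

/-- Second-kind Gauss–Chebyshev nodes `x_i = cos((i+1)π/(n+1))`, the zeros of `U_n`.
[cite: DavisRabinowitz1984, Sect. 2.7 (2.7.14)] -/
def gcNode₂ (n i : ℕ) : ℝ := cos (gcAngle₂ n i)

/-- Second-kind Gauss–Chebyshev weights `w_i = π/(n+1) · sin²((i+1)π/(n+1))`.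
[cite: DavisRabinowitz1984, Sect. 2.7 (2.7.14)] -/
def gcWeight₂ (n i : ℕ) : ℝ := π / (n + 1) * sin (gcAngle₂ n i) ^ 2

/-- The `n`-point Gauss–Chebyshev rule of the second kind, `Σ_{i<n} w_i f(x_i)`.
[cite: DavisRabinowitz1984, Sect. 2.7 (2.7.14)] -/
def gaussChebyshevRule₂ (n : ℕ) (f : ℝ → ℝ) : ℝ := ∑ i ∈ range n, gcWeight₂ n i * f (gcNode₂ n i)

/-- The second-kind weights are positive. [cite: DavisRabinowitz1984, Sect. 2.7 (2.7.14)] -/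
theorem gcWeight₂_pos {n i : ℕ} (hi : i < n) : 0 < gcWeight₂ n i := by
  unfold gcWeight₂ gcAngle₂
  have hπ := Real.pi_pos
  have h1 : (0 : ℝ) < (i + 1) * π / (n + 1) := by positivity
  have h2 : ((i : ℝ) + 1) * π / (n + 1) < π := by
    rw [div_lt_iff₀ (by positivity)]
    have : (i : ℝ) + 1 < n + 1 := by exact_mod_cast Nat.succ_lt_succ hi
    nlinarith
  have hs : 0 < sin (((i : ℝ) + 1) * π / (n + 1)) := sin_pos_of_pos_of_lt_pi h1 h2
  positivity

/-- The second-kind weights sum to `π/2 = ∫_{-1}^{1} (1-x²)^{1/2} dx` — see `gaussChebyshev₂_U` with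
`m = 0` below for the proof via the node sums; recorded here for `n = 1`: the one-point rule is
`(π/2) f(0)`. [cite: DavisRabinowitz1984, Sect. 2.7 (2.7.14)] -/
theorem gaussChebyshevRule₂_one (f : ℝ → ℝ) : gaussChebyshevRule₂ 1 f = π / 2 * f 0 := by
  simp only [gaussChebyshevRule₂, gcWeight₂, gcNode₂, gcAngle₂, sum_range_one, Nat.cast_zero,
    Nat.cast_one, zero_add]
  rw [show (1 : ℝ) * π / (1 + 1) = π / 2 by ring, sin_pi_div_two, cos_pi_div_two]
  ring

/-- The one-point first-kind rule is `π f(0)`. [cite: DavisRabinowitz1984, Sect. 2.7 (2.7.13)] -/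
theorem gaussChebyshevRule₁_one (f : ℝ → ℝ) : gaussChebyshevRule₁ 1 f = π * f 0 := by
  simp only [gaussChebyshevRule₁, gcNode₁, gcAngle₁, sum_range_one, Nat.cast_zero, Nat.cast_one,
    mul_zero, zero_add, mul_one, div_one]
  rw [show (1 : ℝ) * π / 2 = π / 2 by ring, cos_pi_div_two]

/-! ## Linearity of the rules -/

/-- [cite: DavisRabinowitz1984, Sect. 2.7 (2.7.13)] Linearity of the first-kind rule. -/
theorem gaussChebyshevRule₁_add_mul (n : ℕ) (f g : ℝ → ℝ) (c : ℝ) :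
    gaussChebyshevRule₁ n (fun x => f x + c * g x)
      = gaussChebyshevRule₁ n f + c * gaussChebyshevRule₁ n g := by
  simp only [gaussChebyshevRule₁]
  rw [sum_add_distrib, mul_add, mul_sum, mul_sum, mul_sum, mul_sum]
  congr 1
  exact sum_congr rfl fun i _ => by ring

/-- [cite: DavisRabinowitz1984, Sect. 2.7 (2.7.14)] Linearity of the second-kind rule. -/
theorem gaussChebyshevRule₂_add_mul (n : ℕ) (f g : ℝ → ℝ) (c : ℝ) :
    gaussChebyshevRule₂ n (fun x => f x + c * g x)
      = gaussChebyshevRule₂ n f + c * gaussChebyshevRule₂ n g := by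
  simp only [gaussChebyshevRule₂]
  rw [mul_sum, ← sum_add_distrib]
  exact sum_congr rfl fun i _ => by ring

/-! ## Node sums (telescoping) -/

/-- **First-kind node sums**: `Σ_{i<n} cos(m θ_i) = 0` for `0 < m < 2n`, `θ_i = (2i+1)π/(2n)`.
Proof: `2 sin b · cos((2i+1)b) = sin((2i+2)b) - sin(2ib)` with `b = mπ/(2n)` telescopes to
`sin(mπ) = 0`, and `sin b ≠ 0`. [cite: DavisRabinowitz1984, Sect. 2.7 (2.7.13)] -/
theorem sum_cos_mul_gcAngle₁ {n m : ℕ} (hm0 : 0 < m) (hm : m < 2 * n) :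
    ∑ i ∈ range n, cos (m * gcAngle₁ n i) = 0 := by
  have hn : 0 < n := by omega
  have hnR : (0 : ℝ) < n := by exact_mod_cast hn
  set b : ℝ := m * π / (2 * n) with hb
  have hb0 : 0 < b := by
    have : (0 : ℝ) < m := by exact_mod_cast hm0
    positivity
  have hbπ : b < π := by
    rw [hb, div_lt_iff₀ (by positivity)]
    have : (m : ℝ) < 2 * n := by exact_mod_cast hm
    nlinarith [Real.pi_pos]
  have hsin : sin b ≠ 0 := (sin_pos_of_pos_of_lt_pi hb0 hbπ).ne'
  have hangle : ∀ i : ℕ, (m : ℝ) * gcAngle₁ n i = (2 * i + 1) * b := by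
    intro i
    simp only [gcAngle₁, hb]
    field_simp
  have hsum : 2 * sin b * ∑ i ∈ range n, cos (m * gcAngle₁ n i)
      = ∑ i ∈ range n, (sin (2 * ((i + 1 : ℕ) : ℝ) * b) - sin (2 * (i : ℝ) * b)) := by
    rw [mul_sum]
    refine sum_congr rfl fun i _ => ?_
    rw [hangle, Nat.cast_succ,
      show 2 * ((i : ℝ) + 1) * b = (2 * i + 1) * b + b by ring,
      show 2 * (i : ℝ) * b = (2 * i + 1) * b - b by ring, sin_add, sin_sub]
    ring
  rw [sum_range_sub (fun i : ℕ => sin (2 * (i : ℝ) * b)), Nat.cast_zero, mul_zero, zero_mul,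
    sin_zero, sub_zero, show 2 * (n : ℝ) * b = m * π by rw [hb]; field_simp] at hsum
  rw [sin_nat_mul_pi] at hsum
  have h2 : (2 * sin b) ≠ 0 := mul_ne_zero two_ne_zero hsin
  exact (mul_eq_zero.mp hsum).resolve_left h2

/-- **Second-kind node sums**: `Σ_{i<n} cos(m φ_i) = -(1 + (-1)^m)/2` for `0 < m < 2(n+1)`,
`φ_i = (i+1)π/(n+1)`. Proof: with `b = mπ/(2(n+1))`, `2 sin b · cos((2i+2)b) = sin((2i+3)b) - sin((2i+1)b)`
telescopes to `sin((2n+1)b) - sin b = sin(mπ - b) - sin b = -((-1)^m + 1) sin b`.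
[cite: DavisRabinowitz1984, Sect. 2.7 (2.7.14)] -/
theorem sum_cos_mul_gcAngle₂ {n m : ℕ} (hm0 : 0 < m) (hm : m < 2 * (n + 1)) :
    ∑ i ∈ range n, cos (m * gcAngle₂ n i) = -(1 + (-1) ^ m) / 2 := by
  set b : ℝ := m * π / (2 * (n + 1)) with hb
  have hb0 : 0 < b := by
    have : (0 : ℝ) < m := by exact_mod_cast hm0
    positivity
  have hbπ : b < π := by
    rw [hb, div_lt_iff₀ (by positivity)]
    have : (m : ℝ) < 2 * (n + 1) := by exact_mod_cast hm
    nlinarith [Real.pi_pos]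
  have hsin : sin b ≠ 0 := (sin_pos_of_pos_of_lt_pi hb0 hbπ).ne'
  have hangle : ∀ i : ℕ, (m : ℝ) * gcAngle₂ n i = (2 * i + 2) * b := by
    intro i
    simp only [gcAngle₂, hb]
    field_simp
  have hsum : 2 * sin b * ∑ i ∈ range n, cos (m * gcAngle₂ n i)
      = ∑ i ∈ range n, (sin ((2 * ((i + 1 : ℕ) : ℝ) + 1) * b) - sin ((2 * (i : ℝ) + 1) * b)) := by
    rw [mul_sum]
    refine sum_congr rfl fun i _ => ?_
    rw [hangle, Nat.cast_succ,
      show (2 * ((i : ℝ) + 1) + 1) * b = (2 * i + 2) * b + b by ring,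
      show (2 * (i : ℝ) + 1) * b = (2 * i + 2) * b - b by ring, sin_add, sin_sub]
    ring
  rw [sum_range_sub (fun i : ℕ => sin ((2 * (i : ℝ) + 1) * b)), Nat.cast_zero, mul_zero, zero_add,
    one_mul, show (2 * (n : ℝ) + 1) * b = m * π - b by rw [hb]; field_simp; ring, sin_sub,
    sin_nat_mul_pi, cos_nat_mul_pi, zero_mul, zero_sub] at hsum
  -- hsum : 2 * sin b * Σ = -((-1)^m * sin b) - sin b
  have key : sin b * (2 * ∑ i ∈ range n, cos (m * gcAngle₂ n i) + (1 + (-1) ^ m)) = 0 := by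
    linear_combination hsum
  have h3 := (mul_eq_zero.mp key).resolve_left hsin
  linarith

/-! ## The continuous side -/

/-- `∫_0^π cos(mθ) dθ = 0` for a natural number `m ≠ 0`. [folklore] -/
private theorem integral_cos_nat_mul_zero_pi {m : ℕ} (hm : m ≠ 0) :
    ∫ θ in (0:ℝ)..π, cos (m * θ) = 0 := by
  have hmR : (m : ℝ) ≠ 0 := by exact_mod_cast hm
  rw [intervalIntegral.integral_comp_mul_left (fun θ => cos θ) hmR, mul_zero, integral_cos, sin_zero,
    sub_zero, sin_nat_mul_pi, smul_zero]

/-- [folklore] Polynomials in `cos θ` are interval integrable. -/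
private theorem ii_eval_cos (q : ℝ[X]) (a b : ℝ) :
    IntervalIntegrable (fun θ => q.eval (cos θ)) MeasureTheory.volume a b :=
  (q.continuous.comp continuous_cos).intervalIntegrable a b

/-- [folklore] Polynomials in `cos θ` times `sin² θ` are interval integrable. -/
private theorem ii_eval_cos_mul_sin_sq (q : ℝ[X]) (a b : ℝ) :
    IntervalIntegrable (fun θ => q.eval (cos θ) * sin θ ^ 2) MeasureTheory.volume a b :=
  ((q.continuous.comp continuous_cos).mul (continuous_sin.pow 2)).intervalIntegrable a b

/-- `∫_0^π T_m(cos θ) dθ` (`= ∫_{-1}^{1} T_m(x) (1-x²)^{-1/2} dx`) is `π` for `m = 0` and `0` for `m ≥ 1`.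
[cite: DavisRabinowitz1984, Sect. 2.7 (2.7.13)] -/
theorem integral_T_eval_cos (m : ℕ) :
    ∫ θ in (0:ℝ)..π, (T ℝ m).eval (cos θ) = if m = 0 then π else 0 := by
  simp_rw [T_real_cos, Int.cast_natCast]
  split_ifs with hm
  · subst hm; simp
  · exact integral_cos_nat_mul_zero_pi hm

/-- `U_m(cos θ) sin² θ = (cos(mθ) - cos((m+2)θ))/2` (product-to-sum with `U_m(cos θ) sin θ = sin((m+1)θ)`).
[folklore] -/
private theorem U_eval_cos_mul_sin_sq (m : ℕ) (θ : ℝ) :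
    (U ℝ m).eval (cos θ) * sin θ ^ 2 = (cos (m * θ) - cos ((m + 2 : ℕ) * θ)) / 2 := by
  rw [pow_two, ← mul_assoc, U_real_cos, Int.cast_natCast]
  push_cast
  rw [show (m : ℝ) * θ = (m + 1) * θ - θ by ring, show ((m : ℝ) + 2) * θ = (m + 1) * θ + θ by ring,
    cos_sub, cos_add]
  ring

/-- `∫_0^π U_m(cos θ) sin² θ dθ` (`= ∫_{-1}^{1} U_m(x) (1-x²)^{1/2} dx`) is `π/2` for `m = 0` and `0` for
`m ≥ 1`. [cite: DavisRabinowitz1984, Sect. 2.7 (2.7.14)] -/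
theorem integral_U_eval_cos_mul_sin_sq (m : ℕ) :
    ∫ θ in (0:ℝ)..π, (U ℝ m).eval (cos θ) * sin θ ^ 2 = if m = 0 then π / 2 else 0 := by
  have hii : ∀ k : ℕ, IntervalIntegrable (fun x : ℝ => cos ((k : ℝ) * x)) MeasureTheory.volume 0 π :=
    fun k => (by fun_prop : Continuous fun x : ℝ => cos ((k : ℝ) * x)).intervalIntegrable 0 π
  simp_rw [U_eval_cos_mul_sin_sq]
  rw [intervalIntegral.integral_div, intervalIntegral.integral_sub (hii m) (hii (m + 2)),
    integral_cos_nat_mul_zero_pi (m := m + 2) (by omega), sub_zero]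
  split_ifs with hm
  · subst hm; simp
  · rw [integral_cos_nat_mul_zero_pi hm, zero_div]

/-! ## The rules on the Chebyshev bases -/

/-- The first-kind rule on `T_m`: `(π/n) Σ_{i<n} cos(m θ_i)`, which is `π` for `m = 0` and `0` for
`0 < m < 2n`. [cite: DavisRabinowitz1984, Sect. 2.7 (2.7.13)] -/
theorem gaussChebyshevRule₁_T {n m : ℕ} (hm : m < 2 * n) :
    gaussChebyshevRule₁ n (fun x => (T ℝ m).eval x) = if m = 0 then π else 0 := by
  have hn : 0 < n := by omega
  unfold gaussChebyshevRule₁ gcNode₁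
  simp_rw [T_real_cos, Int.cast_natCast]
  split_ifs with hm0
  · subst hm0
    have hnR : (n : ℝ) ≠ 0 := by exact_mod_cast hn.ne'
    simp [hnR]
  · rw [sum_cos_mul_gcAngle₁ (Nat.pos_of_ne_zero hm0) hm, mul_zero]

/-- The second-kind rule on `U_m` in terms of the node sums:
`Σ_{i<n} w_i U_m(x_i) = π/(2(n+1)) · (Σ_{i<n} cos(m φ_i) - Σ_{i<n} cos((m+2) φ_i))`. [folklore] -/
private theorem gaussChebyshevRule₂_U_eq_sums (n m : ℕ) :
    gaussChebyshevRule₂ n (fun x => (U ℝ m).eval x)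
      = π / (n + 1) / 2 * (∑ i ∈ range n, cos (m * gcAngle₂ n i)
          - ∑ i ∈ range n, cos ((m + 2 : ℕ) * gcAngle₂ n i)) := by
  unfold gaussChebyshevRule₂
  have hw : ∀ i : ℕ, gcWeight₂ n i * (U ℝ m).eval (gcNode₂ n i)
      = π / (n + 1) / 2 * (cos (m * gcAngle₂ n i) - cos ((m + 2 : ℕ) * gcAngle₂ n i)) := by
    intro i
    unfold gcWeight₂ gcNode₂
    rw [mul_assoc, mul_comm (sin _ ^ 2), U_eval_cos_mul_sin_sq]
    ring
  simp_rw [hw]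
  rw [← mul_sum, sum_sub_distrib]

/-- The second-kind rule on `U_m` is `π/2` for `m = 0` and `0` for `0 < m < 2n`.
[cite: DavisRabinowitz1984, Sect. 2.7 (2.7.14)] -/
theorem gaussChebyshevRule₂_U {n m : ℕ} (hm : m < 2 * n) :
    gaussChebyshevRule₂ n (fun x => (U ℝ m).eval x) = if m = 0 then π / 2 else 0 := by
  have hn : 0 < n := by omega
  rw [gaussChebyshevRule₂_U_eq_sums, sum_cos_mul_gcAngle₂ (m := m + 2) (by omega) (by omega)]
  split_ifs with hm0
  · subst hm0
    simp only [Nat.cast_zero, zero_mul, cos_zero, sum_const, card_range, zero_add]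
    have hnR : (n : ℝ) + 1 ≠ 0 := by positivity
    field_simp
    ring
  · rw [sum_cos_mul_gcAngle₂ (Nat.pos_of_ne_zero hm0) (by omega), pow_add, neg_one_sq, mul_one,
      sub_self, mul_zero]

/-- **Exactness of (2.7.13) on the Chebyshev basis**: `∫_0^π T_m(cos θ) dθ = (π/n) Σ_{i<n} T_m(x_i)` for
`m ≤ 2n - 1`. [cite: DavisRabinowitz1984, Sect. 2.7 (2.7.13)] -/
theorem gaussChebyshev₁_exact_T {n m : ℕ} (hm : m < 2 * n) :
    ∫ θ in (0:ℝ)..π, (T ℝ m).eval (cos θ) = gaussChebyshevRule₁ n (fun x => (T ℝ m).eval x) := by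
  rw [integral_T_eval_cos, gaussChebyshevRule₁_T hm]

/-- **Exactness of (2.7.14) on the Chebyshev basis**: `∫_0^π U_m(cos θ) sin²θ dθ = Σ_{i<n} w_i U_m(x_i)`
for `m ≤ 2n - 1`. [cite: DavisRabinowitz1984, Sect. 2.7 (2.7.14)] -/
theorem gaussChebyshev₂_exact_U {n m : ℕ} (hm : m < 2 * n) :
    ∫ θ in (0:ℝ)..π, (U ℝ m).eval (cos θ) * sin θ ^ 2
      = gaussChebyshevRule₂ n (fun x => (U ℝ m).eval x) := by
  rw [integral_U_eval_cos_mul_sin_sq, gaussChebyshevRule₂_U hm]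

/-! ## Precision `2n - 1` for all polynomials -/

/-- [folklore] A functional on `ℝ[X]` with `E (q + c·p) = E q + c E p` that vanishes on one polynomial
of each exact degree `d ≤ D` vanishes on every polynomial of degree `≤ D` (induction on the degree,
peeling off the leading term). -/
private theorem functional_eq_zero_of_basis (E : ℝ[X] → ℝ)
    (hE : ∀ (q p : ℝ[X]) (c : ℝ), E (q + C c * p) = E q + c * E p)
    (B : ℕ → ℝ[X]) (hBdeg : ∀ d, (B d).natDegree = d) (hBne : ∀ d, B d ≠ 0)
    {D : ℕ} (hB : ∀ d ≤ D, E (B d) = 0) :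
    ∀ p : ℝ[X], p.natDegree ≤ D → E p = 0 := by
  have hE0 : E 0 = 0 := by
    have h := hE 0 0 1
    rw [mul_zero, add_zero, one_mul] at h
    linarith
  intro p
  induction hd : p.natDegree using Nat.strong_induction_on generalizing p with
  | _ d ih =>
    intro hdD
    by_cases hp0 : p = 0
    · rw [hp0]; exact hE0
    have hBlc : (B d).leadingCoeff ≠ 0 := leadingCoeff_ne_zero.mpr (hBne d)
    set c : ℝ := p.leadingCoeff / (B d).leadingCoeff with hc
    have hc0 : c ≠ 0 := div_ne_zero (leadingCoeff_ne_zero.mpr hp0) hBlc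
    set q : ℝ[X] := p - C c * B d with hq
    have hpq : p = q + C c * B d := by rw [hq, sub_add_cancel]
    have hEq : E q = 0 := by
      by_cases hq0 : q = 0
      · rw [hq0]; exact hE0
      · have hdeg : q.natDegree < d := by
          rw [← hd]
          refine natDegree_lt_natDegree hq0 ?_
          rw [hq]
          apply degree_sub_lt
          · rw [degree_C_mul hc0, degree_eq_natDegree hp0, degree_eq_natDegree (hBne d), hBdeg, hd]
          · exact hp0
          · rw [leadingCoeff_mul, leadingCoeff_C, hc, div_mul_cancel₀ _ hBlc]
        exact ih q.natDegree hdeg q rfl (by omega)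
    rw [hpq, hE, hEq, hB d (by omega), mul_zero, add_zero]

/-- **Precision `2n - 1` of the Gauss–Chebyshev rule of the first kind** (angle form): for every real
polynomial `p` of degree `≤ 2n - 1`, `∫_0^π p(cos θ) dθ = (π/n) Σ_{i<n} p(cos θ_i)`, i.e.
`∫_{-1}^{1} p(x)(1-x²)^{-1/2} dx = (π/n) Σ p(x_i)`. [cite: DavisRabinowitz1984, Sect. 2.7 (2.7.13)] -/
theorem gaussChebyshev₁_exact {n : ℕ} (hn : 0 < n) (p : ℝ[X]) (hp : p.natDegree ≤ 2 * n - 1) :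
    ∫ θ in (0:ℝ)..π, p.eval (cos θ) = gaussChebyshevRule₁ n (fun x => p.eval x) := by
  have key := functional_eq_zero_of_basis
    (fun p : ℝ[X] => (∫ θ in (0:ℝ)..π, p.eval (cos θ)) - gaussChebyshevRule₁ n (fun x => p.eval x))
    ?_ (fun d => T ℝ d) ?_ ?_ (D := 2 * n - 1) ?_ p hp
  · exact sub_eq_zero.mp key
  · intro q r c
    have h1 := gaussChebyshevRule₁_add_mul n (fun x => q.eval x) (fun x => r.eval x) c
    simp only [eval_add, eval_mul, eval_C]
    rw [intervalIntegral.integral_add (ii_eval_cos q _ _) ((ii_eval_cos r _ _).const_mul c),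
      intervalIntegral.integral_const_mul, h1]
    ring
  · intro d; simp
  · intro d; exact leadingCoeff_ne_zero.mp (by rw [leadingCoeff_T]; positivity)
  · intro d hd; exact sub_eq_zero.mpr (gaussChebyshev₁_exact_T (by omega))

/-- **Precision `2n - 1` of the Gauss–Chebyshev rule of the second kind** (angle form): for every real
polynomial `p` of degree `≤ 2n - 1`, `∫_0^π p(cos θ) sin²θ dθ = Σ_{i<n} w_i p(x_i)`, i.e.
`∫_{-1}^{1} p(x)(1-x²)^{1/2} dx = Σ w_i p(x_i)`. [cite: DavisRabinowitz1984, Sect. 2.7 (2.7.14)] -/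
theorem gaussChebyshev₂_exact {n : ℕ} (hn : 0 < n) (p : ℝ[X]) (hp : p.natDegree ≤ 2 * n - 1) :
    ∫ θ in (0:ℝ)..π, p.eval (cos θ) * sin θ ^ 2 = gaussChebyshevRule₂ n (fun x => p.eval x) := by
  have key := functional_eq_zero_of_basis
    (fun p : ℝ[X] => (∫ θ in (0:ℝ)..π, p.eval (cos θ) * sin θ ^ 2)
      - gaussChebyshevRule₂ n (fun x => p.eval x))
    ?_ (fun d => U ℝ d) ?_ ?_ (D := 2 * n - 1) ?_ p hp
  · exact sub_eq_zero.mp key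
  · intro q r c
    have h1 := gaussChebyshevRule₂_add_mul n (fun x => q.eval x) (fun x => r.eval x) c
    have h2 : (fun θ : ℝ => (q + C c * r).eval (cos θ) * sin θ ^ 2)
        = fun θ => q.eval (cos θ) * sin θ ^ 2 + c * (r.eval (cos θ) * sin θ ^ 2) := by
      funext θ; simp only [eval_add, eval_mul, eval_C]; ring
    rw [h2]
    simp only [eval_add, eval_mul, eval_C]
    rw [intervalIntegral.integral_add (ii_eval_cos_mul_sin_sq q _ _)
        ((ii_eval_cos_mul_sin_sq r _ _).const_mul c), intervalIntegral.integral_const_mul, h1]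
    ring
  · intro d; simp
  · intro d; exact leadingCoeff_ne_zero.mp (by rw [leadingCoeff_U_natCast]; positivity)
  · intro d hd; exact sub_eq_zero.mpr (gaussChebyshev₂_exact_U (by omega))

/-! ## Back to the `x` variable: the rules as printed -/

/-- **(2.7.13) as printed**, for polynomials of degree `≤ 2n - 1`:
`∫_{-1}^{1} p(x) / √(1 - x²) dx = (π/n) Σ_{i<n} p(x_i)`, via the Chebyshev substitution `x = cos θ`
(`Literature.MeasureTheory.Integral.integral_div_sqrt_one_sub_sq_substitution`).
[cite: DavisRabinowitz1984, Sect. 2.7 (2.7.13)] -/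
theorem gaussChebyshev₁_exact_x {n : ℕ} (hn : 0 < n) (p : ℝ[X]) (hp : p.natDegree ≤ 2 * n - 1) :
    ∫ x in (-1:ℝ)..1, p.eval x / √(1 - x ^ 2) = gaussChebyshevRule₁ n (fun x => p.eval x) := by
  rw [Literature.MeasureTheory.Integral.integral_div_sqrt_one_sub_sq_substitution (fun x => p.eval x)]
  exact gaussChebyshev₁_exact hn p hp

/-- **(2.7.14) as printed**, for polynomials of degree `≤ 2n - 1`:
`∫_{-1}^{1} p(x) √(1 - x²) dx = Σ_{i<n} w_i p(x_i)` (same substitution, `(1 - x²)/√(1 - x²) = √(1 - x²)` and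
`1 - cos²θ = sin²θ`). [cite: DavisRabinowitz1984, Sect. 2.7 (2.7.14)] -/
theorem gaussChebyshev₂_exact_x {n : ℕ} (hn : 0 < n) (p : ℝ[X]) (hp : p.natDegree ≤ 2 * n - 1) :
    ∫ x in (-1:ℝ)..1, p.eval x * √(1 - x ^ 2) = gaussChebyshevRule₂ n (fun x => p.eval x) := by
  have h1 : (fun x : ℝ => p.eval x * √(1 - x ^ 2)) = fun x => p.eval x * (1 - x ^ 2) / √(1 - x ^ 2) := by
    funext x
    rw [mul_div_assoc, Real.div_sqrt]
  rw [h1, Literature.MeasureTheory.Integral.integral_div_sqrt_one_sub_sq_substitution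
    (fun x => p.eval x * (1 - x ^ 2))]
  simp_rw [← sin_sq]
  exact gaussChebyshev₂_exact hn p hp

/-! ## The defect at degree `2n`: the printed error constants are attained -/

/-- `cos(2n θ_i) = cos((2i+1)π) = -1` at the first-kind angles. [folklore] -/
private theorem cos_two_mul_gcAngle₁ {n : ℕ} (hn : 0 < n) (i : ℕ) :
    cos (((2 * n : ℕ) : ℝ) * gcAngle₁ n i) = -1 := by
  unfold gcAngle₁
  have hnR : (n : ℝ) ≠ 0 := by exact_mod_cast hn.ne'
  rw [show ((2 * n : ℕ) : ℝ) * ((2 * i + 1) * π / (2 * n)) = (i : ℕ) * (2 * π) + π by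
    push_cast; field_simp, cos_nat_mul_two_pi_add_pi]

/-- `cos((2n+2) φ_i) = cos(2(i+1)π) = 1` at the second-kind angles. [folklore] -/
private theorem cos_two_mul_add_two_gcAngle₂ (n i : ℕ) :
    cos (((2 * n + 2 : ℕ) : ℝ) * gcAngle₂ n i) = 1 := by
  unfold gcAngle₂
  have hnR : (n : ℝ) + 1 ≠ 0 := by positivity
  rw [show ((2 * n + 2 : ℕ) : ℝ) * ((i + 1) * π / (n + 1)) = ((i + 1 : ℕ) : ℝ) * (2 * π) by
    push_cast; field_simp, cos_nat_mul_two_pi]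

/-- **Defect of (2.7.13) at degree `2n`**: `∫_0^π T_{2n}(cos θ) dθ - (π/n) Σ_{i<n} T_{2n}(x_i) = π` (the
integral vanishes and `T_{2n}(x_i) = cos((2i+1)π) = -1`); in particular the rule is not exact at degree `2n`.
[cite: DavisRabinowitz1984, Sect. 2.7 (2.7.13)] -/
theorem gaussChebyshev₁_defect {n : ℕ} (hn : 0 < n) :
    (∫ θ in (0:ℝ)..π, (T ℝ (2 * n : ℕ)).eval (cos θ))
      - gaussChebyshevRule₁ n (fun x => (T ℝ (2 * n : ℕ)).eval x) = π := by
  rw [integral_T_eval_cos, if_neg (by omega)]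
  unfold gaussChebyshevRule₁ gcNode₁
  simp_rw [T_real_cos, Int.cast_natCast, cos_two_mul_gcAngle₁ hn]
  have hnR : (n : ℝ) ≠ 0 := by exact_mod_cast hn.ne'
  rw [sum_const, card_range, nsmul_eq_mul]
  field_simp
  ring

/-- **Defect of (2.7.14) at degree `2n`**: `∫_0^π U_{2n}(cos θ) sin²θ dθ - Σ_{i<n} w_i U_{2n}(x_i) = π/2`;
in particular the rule is not exact at degree `2n`. [cite: DavisRabinowitz1984, Sect. 2.7 (2.7.14)] -/
theorem gaussChebyshev₂_defect {n : ℕ} (hn : 0 < n) :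
    (∫ θ in (0:ℝ)..π, (U ℝ (2 * n : ℕ)).eval (cos θ) * sin θ ^ 2)
      - gaussChebyshevRule₂ n (fun x => (U ℝ (2 * n : ℕ)).eval x) = π / 2 := by
  rw [integral_U_eval_cos_mul_sin_sq, if_neg (by omega), gaussChebyshevRule₂_U_eq_sums,
    sum_cos_mul_gcAngle₂ (m := 2 * n) (by omega) (by omega), pow_mul, neg_one_sq, one_pow]
  simp_rw [cos_two_mul_add_two_gcAngle₂]
  rw [sum_const, card_range, nsmul_eq_mul, mul_one]
  have hnR : (n : ℝ) + 1 ≠ 0 := by positivity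
  field_simp
  ring

/-- The first-kind rule is not exact on `T_{2n}`: its precision is exactly `2n - 1`.
[cite: DavisRabinowitz1984, Sect. 2.7 (2.7.13)] -/
theorem gaussChebyshev₁_not_exact_degree_two_mul {n : ℕ} (hn : 0 < n) :
    ∫ θ in (0:ℝ)..π, (T ℝ (2 * n : ℕ)).eval (cos θ)
      ≠ gaussChebyshevRule₁ n (fun x => (T ℝ (2 * n : ℕ)).eval x) := by
  intro h
  have h' := gaussChebyshev₁_defect hn
  rw [h, sub_self] at h'
  exact pi_ne_zero h'.symm

/-- The second-kind rule is not exact on `U_{2n}`: its precision is exactly `2n - 1`.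
[cite: DavisRabinowitz1984, Sect. 2.7 (2.7.14)] -/
theorem gaussChebyshev₂_not_exact_degree_two_mul {n : ℕ} (hn : 0 < n) :
    ∫ θ in (0:ℝ)..π, (U ℝ (2 * n : ℕ)).eval (cos θ) * sin θ ^ 2
      ≠ gaussChebyshevRule₂ n (fun x => (U ℝ (2 * n : ℕ)).eval x) := by
  intro h
  have h' := gaussChebyshev₂_defect hn
  rw [h, sub_self] at h'
  have : (π : ℝ) = 0 := by linarith
  exact pi_ne_zero this

/-! ### The defects are the printed error terms `π/(2^{2n∓1}(2n)!) f^{(2n)}(ξ)` at `f = T_{2n}`, `U_{2n}` -/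

/-- Iterated derivatives of a polynomial function. [folklore] -/
private theorem iteratedDeriv_eval_poly (p : ℝ[X]) (k : ℕ) :
    iteratedDeriv k (fun t => p.eval t) = fun t => (derivative^[k] p).eval t := by
  induction k with
  | zero => simp
  | succ k ih =>
    rw [iteratedDeriv_succ, ih, Function.iterate_succ_apply']
    funext t
    exact Polynomial.deriv _

/-- The top derivative of a polynomial is the constant `(deg p)! · (leading coefficient)`. [folklore] -/
private theorem eval_iterate_derivative_natDegree (p : ℝ[X]) (y : ℝ) :
    (derivative^[p.natDegree] p).eval y = (p.natDegree.factorial : ℝ) * p.leadingCoeff := by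
  have hdeg : (derivative^[p.natDegree] p).natDegree ≤ 0 := by
    have := natDegree_iterate_derivative p p.natDegree
    rw [Nat.sub_self] at this
    exact this
  rw [eq_C_of_natDegree_le_zero hdeg, eval_C, coeff_iterate_derivative, zero_add,
    Nat.descFactorial_self, nsmul_eq_mul, leadingCoeff]

/-- `T_m^{(m)} ≡ 2^{m-1} · m!`: the top derivative of `T_m` (Mathlib: `leadingCoeff_T`). [folklore] -/
private theorem iteratedDeriv_T_self (m : ℕ) (ξ : ℝ) :
    iteratedDeriv m (fun x => (T ℝ m).eval x) ξ = 2 ^ (m - 1) * m.factorial := by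
  have hdeg : (T ℝ (m : ℤ)).natDegree = m := by simp
  have h := eval_iterate_derivative_natDegree (T ℝ (m : ℤ)) ξ
  rw [hdeg, leadingCoeff_T, Int.natAbs_natCast] at h
  rw [iteratedDeriv_eval_poly]
  show (derivative^[m] (T ℝ m)).eval ξ = _
  rw [h, mul_comm]

/-- `U_m^{(m)} ≡ 2^m · m!`: the top derivative of `U_m` (Mathlib: `leadingCoeff_U_natCast`). [folklore] -/
private theorem iteratedDeriv_U_self (m : ℕ) (ξ : ℝ) :
    iteratedDeriv m (fun x => (U ℝ m).eval x) ξ = 2 ^ m * m.factorial := by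
  have hdeg : (U ℝ (m : ℤ)).natDegree = m := natDegree_U_natCast ℝ m
  have h := eval_iterate_derivative_natDegree (U ℝ (m : ℤ)) ξ
  rw [hdeg, leadingCoeff_U_natCast] at h
  rw [iteratedDeriv_eval_poly]
  show (derivative^[m] (U ℝ m)).eval ξ = _
  rw [h, mul_comm]

/-- **The error constant of (2.7.13) is attained.** The defect of the first-kind rule on `f = T_{2n}` equals
the text's error term `π/(2^{2n-1}(2n)!) · f^{(2n)}(ξ)` (for every `ξ`: the `2n`-th derivative of `T_{2n}` is
the constant `2^{2n-1}(2n)!`). [cite: DavisRabinowitz1984, Sect. 2.7 (2.7.13)] -/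
theorem gaussChebyshev₁_defect_eq_errorTerm {n : ℕ} (hn : 0 < n) (ξ : ℝ) :
    (∫ θ in (0:ℝ)..π, (T ℝ (2 * n : ℕ)).eval (cos θ))
        - gaussChebyshevRule₁ n (fun x => (T ℝ (2 * n : ℕ)).eval x)
      = π / (2 ^ (2 * n - 1) * (2 * n).factorial)
          * iteratedDeriv (2 * n) (fun x => (T ℝ (2 * n : ℕ)).eval x) ξ := by
  rw [gaussChebyshev₁_defect hn, iteratedDeriv_T_self]
  have h1 : (2 : ℝ) ^ (2 * n - 1) ≠ 0 := pow_ne_zero _ two_ne_zero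
  have h2 : ((2 * n).factorial : ℝ) ≠ 0 := by exact_mod_cast Nat.factorial_ne_zero _
  field_simp

/-- **The error constant of (2.7.14) is attained.** The defect of the second-kind rule on `f = U_{2n}` equals
the text's error term `π/(2^{2n+1}(2n)!) · f^{(2n)}(ξ)` (for every `ξ`: `U_{2n}^{(2n)} ≡ 2^{2n}(2n)!`).
[cite: DavisRabinowitz1984, Sect. 2.7 (2.7.14)] -/
theorem gaussChebyshev₂_defect_eq_errorTerm {n : ℕ} (hn : 0 < n) (ξ : ℝ) :
    (∫ θ in (0:ℝ)..π, (U ℝ (2 * n : ℕ)).eval (cos θ) * sin θ ^ 2)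
        - gaussChebyshevRule₂ n (fun x => (U ℝ (2 * n : ℕ)).eval x)
      = π / (2 ^ (2 * n + 1) * (2 * n).factorial)
          * iteratedDeriv (2 * n) (fun x => (U ℝ (2 * n : ℕ)).eval x) ξ := by
  rw [gaussChebyshev₂_defect hn, iteratedDeriv_U_self]
  have h1 : (2 : ℝ) ^ (2 * n + 1) ≠ 0 := pow_ne_zero _ two_ne_zero
  have h2 : ((2 * n).factorial : ℝ) ≠ 0 := by exact_mod_cast Nat.factorial_ne_zero _
  field_simp
  ring

/-! ## Relation to Mathlib's Chebyshev–Gauss theorem -/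

/-- Our first-kind rule on a polynomial is Mathlib's `Polynomial.Chebyshev.sumZeroes`
(`(π/n) Σ_{i<n} P(cos((2i+1)/(2n) · π))`). [cite: DavisRabinowitz1984, Sect. 2.7 (2.7.13)] -/
theorem gaussChebyshevRule₁_eq_sumZeroes (n : ℕ) (P : ℝ[X]) :
    gaussChebyshevRule₁ n (fun x => P.eval x) = Polynomial.Chebyshev.sumZeroes n P := by
  unfold gaussChebyshevRule₁ gcNode₁ gcAngle₁ Polynomial.Chebyshev.sumZeroes
  congr 1
  refine sum_congr rfl fun i _ => ?_
  rw [show (2 * (i : ℝ) + 1) * π / (2 * n) = (2 * i + 1) / (2 * n) * π by ring]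

/-- **(2.7.13), exactness, in Mathlib's measure form** — a direct consequence of Mathlib's Chebyshev–Gauss
theorem `Polynomial.Chebyshev.integral_eq_sumZeroes`: `∫ p d(measureT) = (π/n) Σ_{i<n} p(x_i)` for
`deg p ≤ 2n - 1`, where `measureT` is Lebesgue measure on `(-1, 1]` with density `(1 - x²)^{-1/2}`
(consistent with `gaussChebyshev₁_exact` through `Polynomial.Chebyshev.integral_measureT_eq_integral_cos`).
[cite: DavisRabinowitz1984, Sect. 2.7 (2.7.13)] -/
theorem integral_measureT_eq_gaussChebyshevRule₁ {n : ℕ} (hn : 0 < n) (p : ℝ[X])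
    (hp : p.natDegree ≤ 2 * n - 1) :
    ∫ x, p.eval x ∂Polynomial.Chebyshev.measureT = gaussChebyshevRule₁ n (fun x => p.eval x) := by
  rw [gaussChebyshevRule₁_eq_sumZeroes]
  refine Polynomial.Chebyshev.integral_eq_sumZeroes hn.ne' (lt_of_le_of_lt degree_le_natDegree ?_)
  exact_mod_cast (show p.natDegree < 2 * n by omega)

end

end Literature.Analysis.Quadrature
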